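import Literature.NumberTheory.GaloisRepresentations.LocalWeilDatumExtension
import HarnessLib

/-!
# The Weil datum of a non-archimedean local field, X: finite extensions of `E` read inside `F̄`

Continuation of `LocalWeilDatumExtension.lean` (`E/F` finite extension of non-archimedean local
fields, `ι : F̄ ≅ Ē`, `E₀ = ι⁻¹(E)`, `range res = G_{E₀}`):

* `liftGal`, `liftGalHom`: the inverse `G_{E₀} → Γ_E` of the restriction, with
  `liftGal γ • ι a = ι (γ • a)`;
* `embFieldOf L' = ι⁻¹(L')` for `L' ⊆ Ē` an intermediate field over `E`, with `E₀ ≤ ι⁻¹(L')`,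
  `ι⁻¹(L') ≃ₐ[F] L'`, finiteness and separability;
* `weilRestrictE L' : (W_F ∩ G_{E₀}) →* Gal(L'/E)` (through `liftGal` and `AlgEquiv.restrictNormalHom`; cf. the
  tree's `absRestrictNormalHom` of `RamificationFiltration.lean`, not imported here), its kernel
  `W_F ∩ G_{ι⁻¹ L'}` (`weilRestrictE_eq_one_iff`) and its surjectivity for `L'/E` finite Galois
  (`weilRestrictE_surjective`, density of `W_F`);
* for `L'/E` finite abelian, commutators of `W_F ∩ G_{E₀}` lie in `W_F ∩ G_{ι⁻¹ L'}`
  (`commutator_mem_fieldSubgroup_embFieldOf`).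

## References

* J. Tate, *Number theoretic background*, Corvallis 1979, (1.4.1), (1.4.5). [TateCorvallis1979]
-/

noncomputable section

open Field IsNonarchimedeanLocalField ValuativeRel
open scoped Pointwise Valued

namespace Literature.NumberTheory.GaloisRepresentations

namespace LocalWeilDatum

open GaloisRepresentations.IsNonarchimedeanLocalField

section Algebraic

variable (F E : Type*) [Field F] [Field E] [Algebra F E] [Algebra.IsAlgebraic F E]

/-! ### Lifting `G_{E₀}` to `Γ_E` -/

/-- The lift of `γ ∈ G_{E₀} ≤ Γ_F` to `Γ_E` (inverse of the restriction). [folklore] -/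
def liftGal {γ : absoluteGaloisGroup F} (hγ : γ ∈ galFixing F (embField F E)) : absoluteGaloisGroup E :=
  (exists_absGaloisRestrict_eq F E hγ).choose

/-- `res (liftGal γ) = γ`. [folklore] -/
@[simp]
theorem absGaloisRestrict_liftGal {γ : absoluteGaloisGroup F} (hγ : γ ∈ galFixing F (embField F E)) :
    absGaloisRestrict F E (liftGal F E hγ) = γ :=
  (exists_absGaloisRestrict_eq F E hγ).choose_spec

/-- `liftGal (res σ) = σ` (for any membership proof). [folklore] -/
theorem liftGal_absGaloisRestrict (σ : absoluteGaloisGroup E)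
    (h : absGaloisRestrict F E σ ∈ galFixing F (embField F E)) : liftGal F E h = σ :=
  absGaloisRestrict_injective F E (by rw [absGaloisRestrict_liftGal])

/-- `liftGal γ • ι a = ι (γ • a)`. [folklore] -/
theorem liftGal_smul {γ : absoluteGaloisGroup F} (hγ : γ ∈ galFixing F (embField F E)) (a : AlgebraicClosure F) :
    liftGal F E hγ • absClosureEmbedding F E a = absClosureEmbedding F E (γ • a) := by
  rw [← absGaloisRestrict_apply_smul, absGaloisRestrict_liftGal]

/-- `liftGal` does not depend on the membership proof and is determined by `γ`. [folklore] -/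
theorem liftGal_congr {γ γ' : absoluteGaloisGroup F} (hγ : γ ∈ galFixing F (embField F E))
    (hγ' : γ' ∈ galFixing F (embField F E)) (h : γ = γ') : liftGal F E hγ = liftGal F E hγ' := by
  subst h
  rfl

/-- The lift `G_{E₀} →* Γ_E` as a homomorphism. [folklore] -/
def liftGalHom : galFixing F (embField F E) →* absoluteGaloisGroup E where
  toFun γ := liftGal F E γ.2
  map_one' := absGaloisRestrict_injective F E (by rw [absGaloisRestrict_liftGal, map_one]; rfl)
  map_mul' γ γ' := absGaloisRestrict_injective F E (by
    rw [absGaloisRestrict_liftGal, map_mul, absGaloisRestrict_liftGal, absGaloisRestrict_liftGal]; rfl)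

/-- Unfolding `liftGalHom`. [folklore] -/
theorem liftGalHom_apply (γ : galFixing F (embField F E)) : liftGalHom F E γ = liftGal F E γ.2 :=
  rfl

/-! ### `ι⁻¹(L')` for `L' ⊆ Ē` -/

/-- **`ι⁻¹(L') ⊆ F̄`** for an intermediate field `L'` of `Ē/E`. [folklore] -/
def embFieldOf (L' : IntermediateField E (AlgebraicClosure E)) : IntermediateField F (AlgebraicClosure F) :=
  (L'.restrictScalars F).comap (absClosureEmbedding F E)

variable {F E} in
omit [Algebra.IsAlgebraic F E] in
/-- Membership: `a ∈ ι⁻¹(L') ↔ ι a ∈ L'`. [folklore] -/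
theorem mem_embFieldOf_iff {L' : IntermediateField E (AlgebraicClosure E)} {a : AlgebraicClosure F} :
    a ∈ embFieldOf F E L' ↔ absClosureEmbedding F E a ∈ L' :=
  Iff.rfl

omit [Algebra.IsAlgebraic F E] in
/-- `E₀ ≤ ι⁻¹(L')`. [folklore] -/
theorem embField_le_embFieldOf (L' : IntermediateField E (AlgebraicClosure E)) :
    embField F E ≤ embFieldOf F E L' := by
  intro a ha
  obtain ⟨x, hx⟩ := (mem_embField_iff F E).mp ha
  rw [mem_embFieldOf_iff, ← hx]
  exact L'.algebraMap_mem x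

omit [Algebra.IsAlgebraic F E] in
/-- `ι⁻¹` is monotone. [folklore] -/
theorem embFieldOf_mono {L' L'' : IntermediateField E (AlgebraicClosure E)} (h : L' ≤ L'') :
    embFieldOf F E L' ≤ embFieldOf F E L'' :=
  fun _ ha => h ha

/-- `ι⁻¹ x ∈ ι⁻¹(L')` for `x ∈ L'`. [folklore] -/
theorem symm_mem_embFieldOf {L' : IntermediateField E (AlgebraicClosure E)} {x : AlgebraicClosure E} (hx : x ∈ L') :
    (absClosureEquiv F E).symm x ∈ embFieldOf F E L' := by
  rw [mem_embFieldOf_iff, absClosureEmbedding_absClosureEquiv_symm]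
  exact hx

/-- **`ι⁻¹(L') ≃ₐ[F] L'`**. [folklore] -/
def equivEmbFieldOf (L' : IntermediateField E (AlgebraicClosure E)) :
    embFieldOf F E L' ≃ₐ[F] (L'.restrictScalars F) :=
  AlgEquiv.ofBijective
    { toFun := fun a => ⟨absClosureEmbedding F E a, a.2⟩
      map_one' := Subtype.ext (by simp)
      map_mul' := fun a b => Subtype.ext (by simp)
      map_zero' := Subtype.ext (by simp)
      map_add' := fun a b => Subtype.ext (by simp)
      commutes' := fun r => Subtype.ext (by simp) }
    ⟨fun a b h => Subtype.ext ((absClosureEmbedding_bijective F E).1 (congrArg Subtype.val h)),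
      fun y => ⟨⟨(absClosureEquiv F E).symm y, symm_mem_embFieldOf F E y.2⟩,
        Subtype.ext (absClosureEmbedding_absClosureEquiv_symm F E _)⟩⟩

/-- `equivEmbFieldOf a = ι a`. [folklore] -/
@[simp]
theorem coe_equivEmbFieldOf (L' : IntermediateField E (AlgebraicClosure E)) (a : embFieldOf F E L') :
    ((equivEmbFieldOf F E L' a : L'.restrictScalars F) : AlgebraicClosure E) = absClosureEmbedding F E a :=
  rfl

/-- `ι⁻¹(L')` is finite over `F` when `L'/E` and `E/F` are finite. [folklore] -/
theorem finiteDimensional_embFieldOf [FiniteDimensional F E] (L' : IntermediateField E (AlgebraicClosure E))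
    [FiniteDimensional E L'] : FiniteDimensional F (embFieldOf F E L') := by
  haveI : FiniteDimensional F (L'.restrictScalars F) := by
    change FiniteDimensional F L'
    exact Module.Finite.trans E L'
  exact LinearEquiv.finiteDimensional (equivEmbFieldOf F E L').symm.toLinearEquiv

/-- `ι⁻¹(L') ⊆ F^sep` when `L'/E` and `E/F` are separable. [folklore] -/
theorem embFieldOf_le_sepClosure [Algebra.IsSeparable F E] (L' : IntermediateField E (AlgebraicClosure E))
    [Algebra.IsSeparable E L'] : embFieldOf F E L' ≤ sepClosure F := by
  rw [le_separableClosure_iff]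
  haveI : Algebra.IsSeparable F (L'.restrictScalars F) := by
    change Algebra.IsSeparable F L'
    exact Algebra.IsSeparable.trans F E L'
  exact Algebra.IsSeparable.of_algHom F _ (equivEmbFieldOf F E L').toAlgHom

/-! ### Restriction `W_F ∩ G_{E₀} → Gal(L'/E)` -/

/-- `Γ_E` preserves a normal `L' ⊆ Ē`. [folklore] -/
theorem smul_mem_of_normal (L' : IntermediateField E (AlgebraicClosure E)) [Normal E L']
    (σ : absoluteGaloisGroup E) {y : AlgebraicClosure E} (hy : y ∈ L') : σ • y ∈ L' := by
  have h := AlgEquiv.restrictNormal_commutes (absoluteGaloisGroup.toAlgEquiv E σ) L' ⟨y, hy⟩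
  rw [absoluteGaloisGroup.smul_def]
  change (absoluteGaloisGroup.toAlgEquiv E σ) ((⟨y, hy⟩ : L') : AlgebraicClosure E) ∈ L'
  rw [show ((⟨y, hy⟩ : L') : AlgebraicClosure E) = algebraMap L' (AlgebraicClosure E) ⟨y, hy⟩ from rfl, ← h]
  exact SetLike.coe_mem _

end Algebraic

section Local

variable (F E : Type*) [Field F] [ValuativeRel F] [TopologicalSpace F] [IsNonarchimedeanLocalField F]
  [Field E] [Algebra F E] [Algebra.IsAlgebraic F E]

/-- `W_F ∩ G_K → G_K` (the inclusion `toAbsGalois` with values in the subgroup). [folklore] -/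
def toGalFixing (K : IntermediateField F (AlgebraicClosure F)) : fieldSubgroup F K →* galFixing F K :=
  ((WeilGroup.toAbsGalois F).comp (fieldSubgroup F K).subtype).codRestrict (galFixing F K)
    (fun w => (toAbsGalois_mem_galFixing_iff (F := F)).mpr w.2)

/-- Unfolding `toGalFixing`. [folklore] -/
@[simp]
theorem coe_toGalFixing (K : IntermediateField F (AlgebraicClosure F)) (w : fieldSubgroup F K) :
    ((toGalFixing F K w : galFixing F K) : absoluteGaloisGroup F) = WeilGroup.toAbsGalois F (w : WeilGroup F) :=
  rfl

/-- **Restriction `W_F ∩ G_{E₀} →* Gal(L'/E)`**: lift to `Γ_E` (`liftGalHom`) and restrict to the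
normal `L'`. [cite: TateCorvallis1979, (1.4.5)] -/
def weilRestrictE (L' : IntermediateField E (AlgebraicClosure E)) [Normal E L'] :
    fieldSubgroup F (embField F E) →* (L' ≃ₐ[E] L') :=
  ((AlgEquiv.restrictNormalHom L').comp (absoluteGaloisGroup.toAlgEquiv E).toMonoidHom).comp
    ((liftGalHom F E).comp (toGalFixing F (embField F E)))

/-- Unfolding `weilRestrictE`: restrict the lift of `toAbsGalois w`. [folklore] -/
theorem weilRestrictE_apply (L' : IntermediateField E (AlgebraicClosure E)) [Normal E L']
    (w : fieldSubgroup F (embField F E)) :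
    weilRestrictE F E L' w = AlgEquiv.restrictNormalHom L'
      (absoluteGaloisGroup.toAlgEquiv E (liftGal F E ((toAbsGalois_mem_galFixing_iff (F := F)).mpr w.2))) :=
  rfl

/-- `weilRestrictE w` is the restriction to `L'` of the lift of `w` to `Γ_E` (form with
`AlgEquiv.restrictNormalHom`, as in `IsReciprocitySystem`). [folklore] -/
theorem restrictNormalHom_liftGal (L' : IntermediateField E (AlgebraicClosure E)) [Normal E L']
    (w : fieldSubgroup F (embField F E)) :
    ((AlgEquiv.restrictNormalHom L').comp (absoluteGaloisGroup.toAlgEquiv E).toMonoidHom)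
        (liftGal F E ((toAbsGalois_mem_galFixing_iff (F := F)).mpr w.2)) = weilRestrictE F E L' w :=
  rfl

/-- `weilRestrictE w` acts on `x ∈ L'` as the lift of `w`. [folklore] -/
theorem coe_weilRestrictE_apply (L' : IntermediateField E (AlgebraicClosure E)) [Normal E L']
    (w : fieldSubgroup F (embField F E)) (x : L') :
    ((weilRestrictE F E L' w x : L') : AlgebraicClosure E) =
      liftGal F E ((toAbsGalois_mem_galFixing_iff (F := F)).mpr w.2) • (x : AlgebraicClosure E) := by
  rw [weilRestrictE_apply, AlgEquiv.restrictNormalHom_apply, absoluteGaloisGroup.smul_def]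

/-- `weilRestrictE w` on `ι a`, `a ∈ ι⁻¹(L')`: it is `ι (w • a)`. [folklore] -/
theorem coe_weilRestrictE_apply_mk (L' : IntermediateField E (AlgebraicClosure E)) [Normal E L']
    (w : fieldSubgroup F (embField F E)) {a : AlgebraicClosure F} (ha : a ∈ embFieldOf F E L') :
    ((weilRestrictE F E L' w ⟨absClosureEmbedding F E a, ha⟩ : L') : AlgebraicClosure E) =
      absClosureEmbedding F E (WeilGroup.toAbsGalois F (w : WeilGroup F) • a) := by
  rw [coe_weilRestrictE_apply, liftGal_smul]

/-- **Kernel of `W_F ∩ G_{E₀} → Gal(L'/E)`**: it is `W_F ∩ G_{ι⁻¹ L'}`. [cite: TateCorvallis1979, (1.4.5)] -/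
theorem weilRestrictE_eq_one_iff (L' : IntermediateField E (AlgebraicClosure E)) [Normal E L']
    (w : fieldSubgroup F (embField F E)) :
    weilRestrictE F E L' w = 1 ↔ (w : WeilGroup F) ∈ fieldSubgroup F (embFieldOf F E L') := by
  rw [mem_fieldSubgroup_iff]
  constructor
  · intro h a ha
    apply (absClosureEmbedding_bijective F E).1
    rw [← coe_weilRestrictE_apply_mk F E L' w ha, h, AlgEquiv.one_apply]
  · intro h
    ext x
    have hx : (absClosureEquiv F E).symm (x : AlgebraicClosure E) ∈ embFieldOf F E L' := symm_mem_embFieldOf F E x.2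
    have hx' : (⟨absClosureEmbedding F E ((absClosureEquiv F E).symm (x : AlgebraicClosure E)), by
        rw [absClosureEmbedding_absClosureEquiv_symm]; exact x.2⟩ : L') = x :=
      Subtype.ext (absClosureEmbedding_absClosureEquiv_symm F E _)
    rw [AlgEquiv.one_apply, ← hx', coe_weilRestrictE_apply_mk F E L' w hx, h _ hx]

/-- Two elements of `W_F ∩ G_{E₀}` restrict equally iff congruent modulo `W_F ∩ G_{ι⁻¹ L'}`. [folklore] -/
theorem weilRestrictE_eq_iff (L' : IntermediateField E (AlgebraicClosure E)) [Normal E L']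
    (w w' : fieldSubgroup F (embField F E)) :
    weilRestrictE F E L' w = weilRestrictE F E L' w' ↔
      ((w : WeilGroup F))⁻¹ * w' ∈ fieldSubgroup F (embFieldOf F E L') := by
  rw [show ((w : WeilGroup F)⁻¹ * w' : WeilGroup F) = ((w⁻¹ * w' : fieldSubgroup F (embField F E)) : WeilGroup F)
    from rfl, ← weilRestrictE_eq_one_iff, map_mul, map_inv, inv_mul_eq_one, eq_comm]

omit [ValuativeRel F] [TopologicalSpace F] [IsNonarchimedeanLocalField F] in
/-- Elements of `G_{ι⁻¹ L'}` lift to elements acting trivially on `L'`. [folklore] -/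
theorem restrictNormalHom_liftGal_eq_one (L' : IntermediateField E (AlgebraicClosure E)) [Normal E L']
    {τ : absoluteGaloisGroup F} (hτ : τ ∈ galFixing F (embFieldOf F E L')) :
    AlgEquiv.restrictNormalHom L' (absoluteGaloisGroup.toAlgEquiv E
      (liftGal F E (galFixing_antitone F (embField_le_embFieldOf F E L') hτ))) = 1 := by
  ext x
  have hx : (absClosureEquiv F E).symm (x : AlgebraicClosure E) ∈ embFieldOf F E L' := symm_mem_embFieldOf F E x.2
  rw [AlgEquiv.restrictNormalHom_apply, AlgEquiv.one_apply, ← absoluteGaloisGroup.smul_def,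
    ← absClosureEmbedding_absClosureEquiv_symm F E (x : AlgebraicClosure E),
    liftGal_smul, (mem_galFixing_iff F).mp hτ _ hx]

/-- **`W_F ∩ G_{E₀} → Gal(L'/E)` is onto** for `L'/E` finite Galois and `E/F` finite: lift
`g` to `Γ_E`, restrict to `Γ_F`, and move to the dense `W_F` inside the coset modulo the open
`G_{ι⁻¹ L'}`. [cite: TateCorvallis1979, (1.4.1), (1.4.5)] -/
theorem weilRestrictE_surjective [FiniteDimensional F E] (L' : IntermediateField E (AlgebraicClosure E))
    [FiniteDimensional E L'] [Normal E L'] : Function.Surjective (weilRestrictE F E L') := by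
  haveI := finiteDimensional_embFieldOf F E L'
  intro g
  obtain ⟨σ, hσ⟩ := (AlgEquiv.restrictNormalHom_surjective (F := E) (K₁ := L') (E := AlgebraicClosure E)) g
  have hγE : absGaloisRestrict F E ((absoluteGaloisGroup.toAlgEquiv E).symm σ) ∈ galFixing F (embField F E) :=
    absGaloisRestrict_mem_galFixing F E _
  have hdense := WeilGroup.denseRange_toAbsGalois_holds F
  obtain ⟨w, hw⟩ := hdense.exists_mem_open
    ((isOpen_galFixing F (embFieldOf F E L')).smul (absGaloisRestrict F E ((absoluteGaloisGroup.toAlgEquiv E).symm σ)))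
    ⟨_, Set.mem_smul_set.mpr ⟨1, (galFixing F _).one_mem, mul_one _⟩⟩
  obtain ⟨τ, hτ, hwτ⟩ := Set.mem_smul_set.mp hw
  have hτE : τ ∈ galFixing F (embField F E) := galFixing_antitone F (embField_le_embFieldOf F E L') hτ
  have hwE : w ∈ fieldSubgroup F (embField F E) := by
    rw [← toAbsGalois_mem_galFixing_iff, ← hwτ, smul_eq_mul]
    exact (galFixing F _).mul_mem hγE hτE
  refine ⟨⟨w, hwE⟩, ?_⟩
  have key : weilRestrictE F E L' ⟨w, hwE⟩ =
      ((AlgEquiv.restrictNormalHom L').comp (absoluteGaloisGroup.toAlgEquiv E).toMonoidHom)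
        (liftGal F E hγE * liftGal F E hτE) := by
    rw [← restrictNormalHom_liftGal]
    congr 1
    apply absGaloisRestrict_injective F E
    rw [map_mul, absGaloisRestrict_liftGal, absGaloisRestrict_liftGal, absGaloisRestrict_liftGal, ← hwτ, smul_eq_mul]
  rw [key, map_mul]
  change AlgEquiv.restrictNormalHom L' (absoluteGaloisGroup.toAlgEquiv E (liftGal F E hγE)) *
    AlgEquiv.restrictNormalHom L' (absoluteGaloisGroup.toAlgEquiv E (liftGal F E hτE)) = g
  rw [restrictNormalHom_liftGal_eq_one F E L' hτ, mul_one, liftGal_absGaloisRestrict, MulEquiv.apply_symm_apply]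
  exact hσ

/-- **Commutators of `W_F ∩ G_{E₀}` fix `ι⁻¹(L')`** for `L'/E` finite abelian: they restrict to
commutators in the abelian `Gal(L'/E)`. [folklore] -/
theorem commutator_mem_fieldSubgroup_embFieldOf (L' : IntermediateField E (AlgebraicClosure E))
    [IsAbelianGalois E L'] {a b : WeilGroup F} (ha : a ∈ fieldSubgroup F (embField F E))
    (hb : b ∈ fieldSubgroup F (embField F E)) :
    a * b * a⁻¹ * b⁻¹ ∈ fieldSubgroup F (embFieldOf F E L') := by
  have hab : weilRestrictE F E L' ⟨a, ha⟩ * weilRestrictE F E L' ⟨b, hb⟩ =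
      weilRestrictE F E L' ⟨b, hb⟩ * weilRestrictE F E L' ⟨a, ha⟩ :=
    IsMulCommutative.is_comm.comm _ _
  have h := (weilRestrictE_eq_one_iff F E L' (⟨a, ha⟩ * ⟨b, hb⟩ * ⟨a, ha⟩⁻¹ * ⟨b, hb⟩⁻¹)).mp (by
    rw [map_mul, map_mul, map_mul, map_inv, map_inv, hab, mul_inv_cancel_right, mul_inv_cancel])
  simpa only [Subgroup.coe_mul, Subgroup.coe_inv] using h

/-- `W_F ∩ G_{E₀}` normalises `W_F ∩ G_{ι⁻¹ L'}` for `L'/E` normal. [folklore] -/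
theorem fieldSubgroup_embField_le_normalizer (L' : IntermediateField E (AlgebraicClosure E)) [Normal E L'] :
    fieldSubgroup F (embField F E) ≤
      Subgroup.normalizer ((fieldSubgroup F (embFieldOf F E L') : Subgroup (WeilGroup F)) : Set (WeilGroup F)) := by
  intro w hw
  rw [Subgroup.mem_normalizer_iff]
  intro v
  constructor
  · intro hv
    have hvE : v ∈ fieldSubgroup F (embField F E) := fieldSubgroup_antitone F (embField_le_embFieldOf F E L') hv
    have h1 := (weilRestrictE_eq_one_iff F E L' ⟨v, hvE⟩).mpr hv
    have h2 := (weilRestrictE_eq_one_iff F E L' (⟨w, hw⟩ * ⟨v, hvE⟩ * ⟨w, hw⟩⁻¹)).mp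
      (by rw [map_mul, map_mul, map_inv, h1, mul_one, mul_inv_cancel])
    simpa only [Subgroup.coe_mul, Subgroup.coe_inv] using h2
  · intro hv
    have hvE : w * v * w⁻¹ ∈ fieldSubgroup F (embField F E) :=
      fieldSubgroup_antitone F (embField_le_embFieldOf F E L') hv
    have hvE' : v ∈ fieldSubgroup F (embField F E) := by
      have := (fieldSubgroup F (embField F E)).mul_mem
        ((fieldSubgroup F (embField F E)).mul_mem ((fieldSubgroup F (embField F E)).inv_mem hw) hvE) hw
      simpa [mul_assoc] using this
    have h1 := (weilRestrictE_eq_one_iff F E L' ⟨_, hvE⟩).mpr hv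
    have h2 : weilRestrictE F E L' ⟨v, hvE'⟩ = 1 := by
      have : (⟨v, hvE'⟩ : fieldSubgroup F (embField F E)) = ⟨w, hw⟩⁻¹ * ⟨_, hvE⟩ * ⟨w, hw⟩ :=
        Subtype.ext (by simp [mul_assoc])
      rw [this, map_mul, map_mul, map_inv, h1, mul_one, inv_mul_cancel]
    exact (weilRestrictE_eq_one_iff F E L' ⟨v, hvE'⟩).mp h2

end Local

end LocalWeilDatum

end Literature.NumberTheory.GaloisRepresentations
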